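import Literature.NumberTheory.Automorphic.Liu2021.Def411WeilCarriers
import Literature.NumberTheory.Automorphic.UnitaryGroupAdelicOneTorus
import HarnessLib

/-!
# Automorphic characters of `E¹ \ E¹(𝔸_{F,f})` are unitary (`‖χ u‖ = 1` for `χ ∈ Chi`)

Topic `NumberTheory/Automorphic`; namespaces `Literature.NumberTheory.Automorphic.UnitaryGroup` (§§0–2, the
torus-level statements) and `Literature.NumberTheory.Automorphic.Liu2021.Def411WeilCarriers` (§3, the statements for the
index type `Chi F E c` of [Liu2021, Def. 4.11 / Thm. 4.18]).  KERNEL ONLY: theorems, 0 definitions, 0 records, 0 named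
facts, 0 sorry.

For a quadratic extension `E/F` of number fields with non-trivial automorphism `c` the norm-one torus
`U(1) = U(1)_{E/F} = ker (N_{E/F} : Res_{E/F} 𝔾_m → 𝔾_m)` is ANISOTROPIC, so its automorphic quotient
`[U(1)] = E¹ \ U(1)(𝔸_F)` is COMPACT — in the tree: `compactSpace_relNormOneQuot F E` (`RelNormOneTorus`, Godement's
criterion [Godement1964, §5 Thm. 4] proved for this torus from the compactness of `𝕀_E¹/Eˣ`), with
`UnitaryGroup.adelicOne F E c = relNormOneIdeles F E` (`UnitaryGroupAdelicOneTorus`).  Consequently every continuous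
character of the FINITE-adelic torus `U(1)(𝔸_{F,f}) = UnitaryGroup.finAdelicOne F E c` (`UnitaryGroupFinAdelicCenter`)
that is trivial on the rational points `E¹ = {x ∈ Eˣ | c(x) x = 1}` is UNITARY:

* §0 (private) a continuous `ℂˣ`-valued character of a compact group takes values of norm `1` (its norm has bounded,
  hence trivial, image in `ℝ_{>0}`);
* §1 the finite part `u ↦ u_f` (the tree's `finitePart`) maps `adelicOne F E c` to `finAdelicOne F E c`
  (`finitePart_mem_finAdelicOne`) SURJECTIVELY (`(1, u)_f = u`: `finiteIdele_mem_adelicOne`,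
  `exists_mem_adelicOne_finitePart_eq`), and principal idèles to principal finite idèles;
* §2 **`UnitaryGroup.norm_apply_eq_one_of_trivial_on_ratOne`**: for `[E : F] = 2`, `c ≠ 1`, a continuous
  `χ : finAdelicOne F E c →* ℂˣ` with `χ((x)) = 1` for every `x ∈ E¹` satisfies `‖χ u‖ = 1` for all `u` — the character
  `y ↦ χ(y_f)` of `U(1)(𝔸_F) = relNormOneIdeles F E` kills `relNormOneRat F E` (principal idèles have principal finite
  part), descends to the compact `[U(1)]`, is unitary there by §0, and `u = (1, u)_f`;
* §3 **`Def411WeilCarriers.norm_chi_apply_eq_one`** (`χ : Chi F E c`), its line form `norm_lineChar_apply_eq_one`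
  (`χ_W = χ ∘ (u · 1_W ↦ u)` on `U(J_W)(𝔸_{F,f})`), and the CM specialisations `norm_chi_apply_eq_one_cm` /
  `norm_lineChar_apply_eq_one_cm` (`F = L⁺`, `E = L`, `c` = complex conjugation; `[L : L⁺] = 2` and `c ≠ 1` from
  `IsCMField`) — exactly the hypothesis `hχn : ∀ u, ‖((χ.1 u : ℂˣ) : ℂ)‖ = 1` of
  `Def411WeilCarriers.rho_isIrreducible_of_lemD1AsPrinted_of_factors` (`Def411IrreducibleOfLemD1AsPrinted`), i.e. the
  residual (ρ2) «automorphic ⇒ unitary» of the `hirr ↦ hD1` junction, now a theorem.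

What is NOT here: archimedean components (the characters of [Liu2021, Def. 4.11] are typed on the finite-adelic torus;
the archimedean torus `∏_{w∣∞} U(1)` is compact and plays no role), Pontryagin duality, any statement about `L`-functions.

## References
* Y. Liu, *Fourier–Jacobi cycles and arithmetic relative trace formula*, Camb. J. Math. 9 (2021), Def. 4.11
  (FJcycle.tex l. 2090: «an automorphic character `χ = ⊗ χ_v : E¹\(𝔸_E^∞)¹ → ℂˣ` (whose value is necessarily in
  `ℂ¹`)» — the parenthetical is exactly what §3 proves), App. D Step 3 (l. 5221). [Liu2021]
* R. Godement, *Domaines fondamentaux des groupes arithmétiques*, Sém. Bourbaki 257 (1962/63), §5 Thm. 4. [Godement1964]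
* V. Platonov, A. Rapinchuk, *Algebraic Groups and Number Theory* (1994), Thm. 5.5, §6.2. [PlatonovRapinchuk1994]
* C. P. Mok, Mem. AMS 235 (2015), §1 Notation p. 5 (`U_{E/F}(1)` = the centre of `U_{E/F}(N)`). [Mok2014]
-/

set_option autoImplicit false

noncomputable section

open NumberField IsDedekindDomain
open _root_.Topology

namespace Literature.NumberTheory.Automorphic

/-! ## §0. Continuous characters of a compact group are unitary -/

section Compact

variable {Γ : Type*} [Group Γ] [TopologicalSpace Γ] [CompactSpace Γ]

/-- **A continuous `ℂˣ`-valued character of a compact group is unitary**: `‖ψ γ‖ = 1`.  The continuous function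
`γ ↦ ‖ψ γ‖` has compact, hence bounded, range; if `‖ψ τ‖ > 1` then `‖ψ τⁿ‖ = ‖ψ τ‖ⁿ` is unbounded, so `‖ψ‖ ≤ 1`
everywhere, and `‖ψ γ‖ ≥ 1` from `‖ψ γ⁻¹‖ ≤ 1`.  (Private helper; the same argument as the tree's
`FramedRep.norm_apply_eq_one_of_compactSpace_normedField`.) [folklore] -/
private theorem norm_apply_eq_one_of_compactSpace_of_continuous (ψ : Γ →* ℂˣ) (hψ : Continuous ψ) (γ : Γ) :
    ‖((ψ γ : ℂˣ) : ℂ)‖ = 1 := by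
  have hc : Continuous fun τ : Γ => ‖((ψ τ : ℂˣ) : ℂ)‖ :=
    continuous_norm.comp (Units.continuous_val.comp hψ)
  obtain ⟨M, hM⟩ := (isCompact_range hc).isBounded.bddAbove
  have hle : ∀ τ : Γ, ‖((ψ τ : ℂˣ) : ℂ)‖ ≤ 1 := fun τ => not_lt.mp fun hlt => by
    obtain ⟨m, hm⟩ := pow_unbounded_of_one_lt M hlt
    have hm' : ‖((ψ τ : ℂˣ) : ℂ)‖ ^ m ≤ M := by
      have h := hM (Set.mem_range_self (τ ^ m))
      simpa only [map_pow, Units.val_pow_eq_pow_val, norm_pow] using h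
    exact absurd hm' (not_le.mpr hm)
  refine le_antisymm (hle γ) ?_
  have h1 := hle γ⁻¹
  rw [map_inv, Units.val_inv_eq_inv_val, norm_inv] at h1
  exact (inv_le_one₀ (norm_pos_iff.mpr (Units.ne_zero _))).mp h1

end Compact

/-! ## §1. The finite part `U(1)(𝔸_F) → U(1)(𝔸_{F,f})` of the norm-one torus -/

section FinitePart

variable (K : Type*) [Field K] [NumberField K]

/-- `finitePart : 𝔸_Kˣ → (𝔸_K^∞)ˣ` (`NormOneIdeleClassCompact`) is continuous for the units topologies (units
functoriality of the continuous projection `𝔸_K = K_∞ × 𝔸_K^∞ → 𝔸_K^∞`; private plumbing). [folklore] -/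
private theorem continuous_finitePart : Continuous (finitePart K) :=
  Continuous.units_map _ continuous_snd

end FinitePart

namespace UnitaryGroup

section FinPart

variable (F E : Type) [Field F] [NumberField F] [Field E] [NumberField E] [Algebra F E] (c : E ≃ₐ[F] E)

omit [NumberField F] in
/-- the finite part of a norm-one idèle is a norm-one finite idèle (project `(c ⊗ 1)(u) · u = 1` to `𝔸_E^∞`).
[cite: Mok2014, §1 Notation p. 5] -/
theorem finitePart_mem_finAdelicOne {u : (AdeleRing (𝓞 E) E)ˣ} (hu : u ∈ adelicOne F E c) :
    finitePart E u ∈ finAdelicOne F E c := by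
  rw [mem_adelicOne_iff] at hu
  rw [mem_finAdelicOne_iff]
  -- the second component of `(c ⊗ 1)(u) · u = 1` in `𝔸_E = E_∞ × 𝔸_E^∞` (all identifications definitional)
  exact congrArg Prod.snd hu

omit [NumberField F] in
/-- **`(1, u)` is a norm-one idèle for `u` a norm-one finite idèle** (`c ⊗ 1` acts componentwise on
`𝔸_E = E_∞ × 𝔸_E^∞` and fixes `1`). [cite: Mok2014, §1 Notation p. 5] -/
theorem finiteIdele_mem_adelicOne (u : finAdelicOne F E c) :
    finiteIdele E (u : (FiniteAdeleRing (𝓞 E) E)ˣ) ∈ adelicOne F E c := by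
  rw [mem_adelicOne_iff]
  refine Prod.ext ?_ ?_
  · show c • (1 : InfiniteAdeleRing E) * 1 = 1
    rw [smul_one, mul_one]
  · show conjFiniteAdele F E c ((u : (FiniteAdeleRing (𝓞 E) E)ˣ) : FiniteAdeleRing (𝓞 E) E) *
        ((u : (FiniteAdeleRing (𝓞 E) E)ˣ) : FiniteAdeleRing (𝓞 E) E) = 1
    exact (mem_finAdelicOne_iff F E c _).1 u.2

omit [NumberField F] in
/-- **the finite part `U(1)(𝔸_F) → U(1)(𝔸_{F,f})` is SURJECTIVE**: every norm-one finite idèle `u` is the finite part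
of the norm-one idèle `(1, u)` — the torus case of `G(𝔸_F) = G_∞ × G(𝔸_{F,f})`. [cite: BorelJacquet1979, §4.1] -/
theorem exists_mem_adelicOne_finitePart_eq (u : finAdelicOne F E c) :
    ∃ U : (AdeleRing (𝓞 E) E)ˣ, U ∈ adelicOne F E c ∧ finitePart E U = (u : (FiniteAdeleRing (𝓞 E) E)ˣ) :=
  ⟨_, finiteIdele_mem_adelicOne F E c u, finitePart_finiteIdele E _⟩

omit [NumberField F] in
/-- the finite part of the principal idèle `(x)` is the principal finite idèle `(x)` (private plumbing: the tree's
`finitePart_principalIdele` with Mathlib's `unitEmbedding` unfolded to `Units.map`). [folklore] -/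
private theorem finitePart_principalIdele_eq_unitsMap (x : Eˣ) :
    finitePart E (GaloisRepresentations.principalIdele E x) =
      Units.map (algebraMap E (FiniteAdeleRing (𝓞 E) E)).toMonoidHom x :=
  Units.ext rfl

end FinPart

/-! ## §2. Continuous characters of `U(1)(𝔸_{F,f})` trivial on `E¹` are unitary -/

section Unitary

variable (F E : Type) [Field F] [NumberField F] [Field E] [NumberField E] [Algebra F E] (c : E ≃ₐ[F] E)

/-- **Automorphic characters of the finite-adelic norm-one torus are unitary.**  For `[E : F] = 2` and `c ≠ 1`, a
continuous character `χ : U(1)(𝔸_{F,f}) → ℂˣ` with `χ((x)) = 1` for every rational norm-one `x ∈ E¹` (embedded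
diagonally) satisfies `‖χ u‖ = 1`: `y ↦ χ(y_f)` is a continuous character of `U(1)(𝔸_F) = relNormOneIdeles F E` trivial on
`E¹ = relNormOneRat F E`, hence a continuous character of the COMPACT quotient `[U(1)]`
(`compactSpace_relNormOneQuot`, Godement's criterion for the anisotropic torus), unitary by §0; and every `u` is `(1, u)_f`.
[cite: Godement1964, §5 Thm. 4] -/
theorem norm_apply_eq_one_of_trivial_on_ratOne (h2 : Module.finrank F E = 2) (hc : c ≠ 1)
    (χ : finAdelicOne F E c →* ℂˣ) (hχc : Continuous χ)
    (hχ : ∀ (x : Eˣ) (hx : Units.map (algebraMap E (FiniteAdeleRing (𝓞 E) E)).toMonoidHom x ∈ finAdelicOne F E c),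
      χ ⟨_, hx⟩ = 1)
    (u : finAdelicOne F E c) : ‖((χ u : ℂˣ) : ℂ)‖ = 1 := by
  -- membership transfer `relNormOneIdeles F E = adelicOne F E c`
  have hmem : ∀ y : relNormOneIdeles F E, ((y : (AdeleRing (𝓞 E) E)ˣ)) ∈ adelicOne F E c := fun y =>
    (mem_adelicOne_iff_mem_relNormOneIdeles F E c h2 hc _).2 y.2
  -- the character `y ↦ χ(y_f)` of the adelic torus
  let φ : relNormOneIdeles F E →* finAdelicOne F E c :=
    ((finitePart E).comp (relNormOneIdeles F E).subtype).codRestrict (finAdelicOne F E c)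
      fun y => finitePart_mem_finAdelicOne F E c (hmem y)
  have hφc : Continuous φ := ((continuous_finitePart E).comp continuous_subtype_val).subtype_mk _
  let ψ : relNormOneIdeles F E →* ℂˣ := χ.comp φ
  have hψc : Continuous ψ := hχc.comp hφc
  -- `ψ` is trivial on the rational points `E¹`
  have hψ : relNormOneRat F E ≤ ψ.ker := by
    intro a ha
    rw [mem_relNormOneRat_iff] at ha
    obtain ⟨x, hx⟩ := ha
    have hx' : Units.map (algebraMap E (FiniteAdeleRing (𝓞 E) E)).toMonoidHom x ∈ finAdelicOne F E c := by
      rw [← finitePart_principalIdele_eq_unitsMap]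
      exact finitePart_mem_finAdelicOne F E c (hx ▸ hmem a)
    have key : φ a = ⟨Units.map (algebraMap E (FiniteAdeleRing (𝓞 E) E)).toMonoidHom x, hx'⟩ := by
      apply Subtype.ext
      show finitePart E (a : (AdeleRing (𝓞 E) E)ˣ) = Units.map (algebraMap E (FiniteAdeleRing (𝓞 E) E)).toMonoidHom x
      rw [← hx]
      exact finitePart_principalIdele_eq_unitsMap E x
    rw [MonoidHom.mem_ker]
    show χ (φ a) = 1
    rw [key]
    exact hχ x hx'
  -- descend to the compact quotient `[U(1)] = E¹ \ U(1)(𝔸_F)`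
  let ψq : relNormOneIdeles F E ⧸ relNormOneRat F E →* ℂˣ := QuotientGroup.lift (relNormOneRat F E) ψ hψ
  have hψqc : Continuous ψq := by
    rw [(QuotientGroup.isQuotientMap_mk (relNormOneRat F E)).continuous_iff]
    exact hψc
  -- `u = (1, u)_f`
  have hU : finiteIdele E (u : (FiniteAdeleRing (𝓞 E) E)ˣ) ∈ relNormOneIdeles F E :=
    (mem_adelicOne_iff_mem_relNormOneIdeles F E c h2 hc _).1 (finiteIdele_mem_adelicOne F E c u)
  have hφU : φ ⟨_, hU⟩ = u := Subtype.ext (finitePart_finiteIdele E _)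
  have hval : ψq (QuotientGroup.mk ⟨_, hU⟩) = χ u := by
    rw [QuotientGroup.lift_mk]
    show χ (φ ⟨_, hU⟩) = χ u
    rw [hφU]
  rw [← hval]
  exact norm_apply_eq_one_of_compactSpace_of_continuous ψq hψqc _

end Unitary

end UnitaryGroup

/-! ## §3. `χ ∈ Chi F E c` is unitary; CM specialisation -/

namespace Liu2021.Def411WeilCarriers

section Chi

variable (F E : Type) [Field F] [NumberField F] [Field E] [NumberField E] [Algebra F E] (c : E ≃ₐ[F] E)

/-- **The automorphic characters `χ ∈ Chi F E c` of [Liu2021, Def. 4.11] are UNITARY**: `‖χ u‖ = 1` on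
`U(1)(𝔸_{F,f})`, for `[E : F] = 2` and `c ≠ 1` (continuity and triviality on `E¹` are the two clauses of
`IsAutomorphicOneChar`; compactness of `E¹ \ U(1)(𝔸_F)`).  This is the print's own parenthetical at l. 2090 — «an
automorphic character `χ = ⊗ χ_v : E¹\(𝔸_E^∞)¹ → ℂˣ` (whose value is necessarily in `ℂ¹`)» — and the hypothesis
`hχn` of `rho_isIrreducible_of_lemD1AsPrinted_of_factors`. [cite: Liu2021, Def. 4.11 (l. 2090)] -/
theorem norm_chi_apply_eq_one (h2 : Module.finrank F E = 2) (hc : c ≠ 1) (χ : Chi F E c)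
    (u : UnitaryGroup.finAdelicOne F E c) : ‖((χ.1 u : ℂˣ) : ℂ)‖ = 1 :=
  UnitaryGroup.norm_apply_eq_one_of_trivial_on_ratOne F E c h2 hc χ.1 χ.2.1 χ.2.2 u

/-- the same in the shape of a hypothesis `∀ u, ‖χ.1 u‖ = 1`. [cite: Liu2021, Def. 4.11 (l. 2090)] -/
theorem norm_chi_eq_one (h2 : Module.finrank F E = 2) (hc : c ≠ 1) (χ : Chi F E c) :
    ∀ u : UnitaryGroup.finAdelicOne F E c, ‖((χ.1 u : ℂˣ) : ℂ)‖ = 1 :=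
  norm_chi_apply_eq_one F E c h2 hc χ

/-- **line form**: the character `χ_W = lineChar a χ` of `U(J_W)(𝔸_{F,f})` (`W = ⟨a⟩`) by which the torus acts in
[Liu2021, App. D Step 3] is unitary. [cite: Liu2021, App. D §D.1 Step 3 (l. 5221)] -/
theorem norm_lineChar_apply_eq_one (h2 : Module.finrank F E = 2) (hc : c ≠ 1) (a : Fˣ) (χ : Chi F E c)
    (g : UnitaryGroup.finAdelic F E c 1 (JW F E a)) : ‖((lineChar F E c a χ.1 g : ℂˣ) : ℂ)‖ = 1 :=
  norm_chi_apply_eq_one F E c h2 hc χ ((lineCenterEquiv F E c a).symm g)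

end Chi

section CM

variable (L : Type) [Field L] [NumberField L] [IsCMField L]

/-- **CM case** (`F = L⁺`, `E = L`, `c` = complex conjugation — the END display's instance): every
`χ ∈ Chi L⁺ L c̄` is unitary, `‖χ u‖ = 1`. [cite: Liu2021, Def. 4.11 (l. 2090)] -/
theorem norm_chi_apply_eq_one_cm (χ : Chi (↥(maximalRealSubfield L)) L (IsCMField.complexConj L))
    (u : UnitaryGroup.finAdelicOne (↥(maximalRealSubfield L)) L (IsCMField.complexConj L)) :
    ‖((χ.1 u : ℂˣ) : ℂ)‖ = 1 :=
  norm_chi_apply_eq_one _ L _ (Algebra.IsQuadraticExtension.finrank_eq_two _ L)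
    (IsCMField.complexConj_ne_one (K := L)) χ u

/-- CM case, hypothesis shape `∀ u, ‖χ.1 u‖ = 1` (the `hχn` of `rho_isIrreducible_of_lemD1AsPrinted_of_factors` at the
END display's carriers). [cite: Liu2021, Def. 4.11 (l. 2090)] -/
theorem norm_chi_eq_one_cm (χ : Chi (↥(maximalRealSubfield L)) L (IsCMField.complexConj L)) :
    ∀ u : UnitaryGroup.finAdelicOne (↥(maximalRealSubfield L)) L (IsCMField.complexConj L), ‖((χ.1 u : ℂˣ) : ℂ)‖ = 1 :=
  norm_chi_apply_eq_one_cm L χ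

/-- CM case, line form: `χ_W` is unitary on `U(J_W)(𝔸_{L⁺,f})`. [cite: Liu2021, App. D §D.1 Step 3 (l. 5221)] -/
theorem norm_lineChar_apply_eq_one_cm (a : (↥(maximalRealSubfield L))ˣ)
    (χ : Chi (↥(maximalRealSubfield L)) L (IsCMField.complexConj L))
    (g : UnitaryGroup.finAdelic (↥(maximalRealSubfield L)) L (IsCMField.complexConj L) 1 (JW (↥(maximalRealSubfield L)) L a)) :
    ‖((lineChar (↥(maximalRealSubfield L)) L (IsCMField.complexConj L) a χ.1 g : ℂˣ) : ℂ)‖ = 1 :=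
  norm_lineChar_apply_eq_one _ L _ (Algebra.IsQuadraticExtension.finrank_eq_two _ L)
    (IsCMField.complexConj_ne_one (K := L)) a χ g

end CM

end Liu2021.Def411WeilCarriers

end Literature.NumberTheory.Automorphic
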